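import Mathlib
import Summits.CriticalPhenomena.PercolationContinuityZ3.Theorems.PercNearOneGluingNoHeavyLowerTailStairKernels
import Summits.CriticalPhenomena.PercolationContinuityZ3.Theorems.PercNearOneGluingNoHeavyLowerTailHurwitzPairPivots
import HarnessLib

/-!
# THEOREM R^prod_2: the operator Hurwitz matrix of an ordered product of two first-order factors

Support file for the Sahi / Conjecture-P programme of route `PercNearOneGluingNoHeavy`
(`--supports stmt-CriticalPhenomena-4575`, prover prim-l12-p5 gen 50; proof note
`prim-l12-p5/PROOF-DRIFTING-HURWITZ-g50.md` §3).  No definitions, no named facts, no sorries.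

CONJECTURE R^prod (prim-l12-p5 gen 48) concerns the lower band matrices
`W = (Θ_{β₁} + r₁)(Θ_{β₂} + r₂)⋯(Θ_{β_m} + r_m)` with `Θ_β = β D + N̂` (`D(k,k-1) = k`, `N̂(k,k) = k`),
`r₁ ≥ 0` and gaps `r_{j+1} - r_j ≥ 1`: their operator Hurwitz matrix — the kernel on the doubled index
`t` with rows `t = 2k ↦ W(k,·)` and `t = 2k+1 ↦ C(k,·)`, `C = SW - WS`, `C(k,l) = W(k+1,l) - W(k,l-1)` —
should be totally nonnegative.  For `m = 2` the bands are
`κ₀(k) = W(k,k) = (k+r₁)(k+r₂)`, `κ₁(k) = W(k,k-1) = k(β₁(k+r₂-1) + β₂(k+r₁))`,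
`κ₂(k) = W(k,k-2) = β₁β₂k(k-1)`.

**THEOREM (`twoFactor_hurwitz_tn`).**  For `β₁, β₂ > 0`, `r₁ > 0`, `r₂ ≥ r₁ + 1` and
`β₁ ≠ β₂ ∨ r₂ > r₁ + 1` (this only excludes the identical unit-gap pair, whose Hurwitz matrix has
vanishing pivots) the kernel is totally nonnegative.  Proof = a five-stage adjacent-row elimination
(the `m = 2` case of the extreme-ray / drifting-Hurwitz normal form of the memo): the kernel is
`E₁·E₂·E₃·E₄·E₅·U` with unit lower bidiagonal `E_i` whose sub-diagonal weights are
`k/2`, `4β₁β₂/K` (`K = β₁r₂ + β₂(1+r₁)`), `a1lo/𝒞`, `𝒞/ŵ`, `ŵ/D₀`, all nonnegative because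
`K·𝒞(k) = 2k(β₁²r₂ + β₂²(r₁+1)) + (β₁r₂ - β₂(r₁+1))² + 4β₁β₂r₂ > 0` and
`ŵ(k+1)·K𝒞(k) = r₂·𝒫₂(k)` with the key pivot
`𝒫₂(k) = r₁L² + 2β₁β₂r₁(r₂-r₁-1) + (β₁-β₂)²k(k+r₁+1) > 0`, `L = β₁(k+r₂) - β₂(k+r₁+1)`
(`keyPivot_pos`); `U` is a staircase kernel (`StairTN.stairs_minor_nonneg`).
-/

namespace Summit.CriticalPhenomena.PercolationContinuityZ3.Theorems

namespace TwoFactorHurwitz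

open Finset Matrix

/-- **The key pivot.**  `𝒫₂(k) = r₁L² + 2β₁β₂r₁(r₂-r₁-1) + (β₁-β₂)²k(k+r₁+1) > 0` for `k ≥ 0`, with
`L = β₁(k+r₂) - β₂(k+r₁+1)`, whenever `β₁,β₂,r₁ > 0`, `r₂ ≥ r₁+1` and the identical unit-gap pair is
excluded. -/
theorem keyPivot_pos (β₁ β₂ r₁ r₂ k : ℝ) (hb₁ : 0 < β₁) (hb₂ : 0 < β₂) (hr₁ : 0 < r₁)
    (hr₂ : r₁ + 1 ≤ r₂) (hne : β₁ ≠ β₂ ∨ r₁ + 1 < r₂) (hk : 0 ≤ k) :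
    0 < r₁ * (β₁ * (k + r₂) - β₂ * (k + r₁ + 1)) ^ 2 + 2 * β₁ * β₂ * r₁ * (r₂ - r₁ - 1)
      + (β₁ - β₂) ^ 2 * (k * (k + r₁ + 1)) := by
  have h3 : 0 ≤ (β₁ - β₂) ^ 2 * (k * (k + r₁ + 1)) := by positivity
  have h1 : 0 ≤ r₁ * (β₁ * (k + r₂) - β₂ * (k + r₁ + 1)) ^ 2 := by positivity
  rcases lt_or_eq_of_le hr₂ with hlt | heq
  · have hδ : 0 < r₂ - r₁ - 1 := by linarith
    have h2 : 0 < 2 * β₁ * β₂ * r₁ * (r₂ - r₁ - 1) := by positivity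
    linarith
  · have hb : β₁ ≠ β₂ := by
      rcases hne with h | h
      · exact h
      · exact absurd heq (ne_of_lt h)
    have hL : β₁ * (k + r₂) - β₂ * (k + r₁ + 1) = (β₁ - β₂) * (k + r₁ + 1) := by rw [← heq]; ring
    have hsub : β₁ - β₂ ≠ 0 := sub_ne_zero.2 hb
    have hkr : 0 < k + r₁ + 1 := by linarith
    have hsq : 0 < (β₁ - β₂) ^ 2 := lt_of_le_of_ne (sq_nonneg _) (Ne.symm (pow_ne_zero 2 hsub))
    have h1' : 0 < r₁ * (β₁ * (k + r₂) - β₂ * (k + r₁ + 1)) ^ 2 := by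
      rw [hL, mul_pow]
      exact mul_pos hr₁ (mul_pos hsq (pow_pos hkr 2))
    have h2 : 2 * β₁ * β₂ * r₁ * (r₂ - r₁ - 1) = 0 := by rw [← heq]; ring
    linarith

/-- **THEOREM R^prod_2.**  The operator Hurwitz matrix (doubled kernel: rows `2k ↦ W(k,·)`,
`2k+1 ↦ C(k,·)`, `C(k,l) = W(k+1,l) - W(k,l-1)`) of the ordered product
`W = (Θ_{β₁} + r₁)(Θ_{β₂} + r₂)` (`κ₀(k) = (k+r₁)(k+r₂)`, `κ₁(k) = k(β₁(k+r₂-1) + β₂(k+r₁))`,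
`κ₂(k) = β₁β₂k(k-1)`) is totally nonnegative for `β₁, β₂ > 0`, `r₁ > 0`, `r₂ ≥ r₁ + 1`,
provided `β₁ ≠ β₂` or `r₂ > r₁ + 1`. -/
theorem twoFactor_hurwitz_tn (β₁ β₂ r₁ r₂ : ℝ) (hb₁ : 0 < β₁) (hb₂ : 0 < β₂) (hr₁ : 0 < r₁)
    (hr₂ : r₁ + 1 ≤ r₂) (hne : β₁ ≠ β₂ ∨ r₁ + 1 < r₂) (κ₀ κ₁ κ₂ : ℕ → ℝ)
    (hκ₀ : ∀ k : ℕ, κ₀ k = ((k : ℝ) + r₁) * ((k : ℝ) + r₂))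
    (hκ₁ : ∀ k : ℕ, κ₁ k = (k : ℝ) * (β₁ * ((k : ℝ) + r₂ - 1) + β₂ * ((k : ℝ) + r₁)))
    (hκ₂ : ∀ k : ℕ, κ₂ k = β₁ * β₂ * ((k : ℝ) * (k - 1)))
    {m : ℕ} (r c : Fin m → ℕ) (hr : StrictMono r) (hc : StrictMono c) :
    0 ≤ (Matrix.of fun i j =>
      if r i % 2 = 0 then
        (if c j = r i / 2 then κ₀ (r i / 2) else if c j + 1 = r i / 2 then κ₁ (r i / 2)
          else if c j + 2 = r i / 2 then κ₂ (r i / 2) else 0)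
      else
        (if c j = r i / 2 + 1 then κ₀ (r i / 2 + 1) - κ₀ (r i / 2)
          else if c j = r i / 2 then κ₁ (r i / 2 + 1) - κ₁ (r i / 2)
          else if c j + 1 = r i / 2 then κ₂ (r i / 2 + 1) - κ₂ (r i / 2) else 0)).det := by
  have hr₂pos : 0 < r₂ := by linarith
  -- lifting row identities to the doubled index (cf. `HurwitzPair.interleave_step`, whose module has
  -- no farm olean at the time of writing; restated locally)
  have interleave_step : ∀ (X Y X' Y' : ℕ → ℕ → ℝ) (eE eO : ℕ → ℝ),
      (∀ l, X 0 l = X' 0 l) → (∀ k l, X (k + 1) l = X' (k + 1) l + eE (k + 1) * Y' k l) →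
      (∀ k l, Y k l = Y' k l + eO k * X' k l) → eE 0 = 0 → ∀ t l : ℕ,
      (if t % 2 = 0 then X (t / 2) l else Y (t / 2) l) =
        (if t % 2 = 0 then X' (t / 2) l else Y' (t / 2) l)
          + (if t % 2 = 0 then eE (t / 2) else eO (t / 2))
            * (if (t - 1) % 2 = 0 then X' ((t - 1) / 2) l else Y' ((t - 1) / 2) l) := by
    intro X Y X' Y' eE eO h0 hE hO heE0 t l
    rcases Nat.even_or_odd' t with ⟨k, rfl | rfl⟩
    · have h1 : (2 * k) % 2 = 0 := by omega
      have h2 : (2 * k) / 2 = k := by omega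
      rw [if_pos h1, if_pos h1, if_pos h1, h2]
      rcases k with _ | k
      · rw [heE0, zero_mul, add_zero]; exact h0 l
      · have h4 : (2 * (k + 1) - 1) / 2 = k := by omega
        rw [if_neg (by omega), h4]
        exact hE k l
    · have h2 : (2 * k + 1) / 2 = k := by omega
      have h3 : (2 * k + 1 - 1) % 2 = 0 := by omega
      have h4 : (2 * k + 1 - 1) / 2 = k := by omega
      rw [if_neg (by omega), if_neg (by omega), if_neg (by omega), if_pos h3, h2, h4]
      exact hO k l
  -- the constant K = κ₁ 1 = β₁ r₂ + β₂ (1 + r₁)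
  set K : ℝ := β₁ * r₂ + β₂ * (1 + r₁) with hKdef
  have hK : 0 < K := by positivity
  have hKne : K ≠ 0 := hK.ne'
  -- differences of the bands
  have hΔ0 : ∀ k : ℕ, κ₀ (k + 1) - κ₀ k = 2 * k + 1 + r₁ + r₂ := by
    intro k; rw [hκ₀, hκ₀]; push_cast; ring
  have hΔ1 : ∀ k : ℕ, κ₁ (k + 1) - κ₁ k = β₁ * (2 * k + r₂) + β₂ * (2 * k + 1 + r₁) := by
    intro k; rw [hκ₁, hκ₁]; push_cast; ring
  have hΔ2 : ∀ k : ℕ, κ₂ (k + 1) - κ₂ k = 2 * β₁ * β₂ * k := by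
    intro k; rw [hκ₂, hκ₂]; push_cast; ring
  have hκ₀0 : κ₀ 0 = r₁ * r₂ := by rw [hκ₀]; simp
  have hΔ0pos : ∀ k : ℕ, 0 < κ₀ (k + 1) - κ₀ k := fun k => by rw [hΔ0]; positivity
  -- stage data (memo §3): the local positive pair (F_k, G_k) in elimination form
  let D0 : ℕ → ℝ := fun k => κ₀ (k + 1) - κ₀ k
  let a1lo : ℕ → ℝ := fun k => (k : ℝ) * K / 2
  let a1hi : ℕ → ℝ := fun k => ((k : ℝ) * (1 + r₁ + r₂) + 2 * r₁ * r₂) / 2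
  let μB1 : ℕ → ℝ := fun k => if k = 0 then 0 else 4 * β₁ * β₂ / K
  let 𝒞 : ℕ → ℝ := fun k => (κ₁ (k + 1) - κ₁ k) - μB1 k * a1hi k
  let μA2 : ℕ → ℝ := fun k => if k = 0 then 0 else a1lo k / 𝒞 (k - 1)
  let ŵ : ℕ → ℝ := fun k => a1hi k - μA2 k * D0 (k - 1)
  -- unfolding facts for the stage data
  have hD0 : ∀ k, D0 k = κ₀ (k + 1) - κ₀ k := fun k => rfl
  have ha1lo_def : ∀ k, a1lo k = (k : ℝ) * K / 2 := fun k => rfl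
  have ha1hi_def : ∀ k, a1hi k = ((k : ℝ) * (1 + r₁ + r₂) + 2 * r₁ * r₂) / 2 := fun k => rfl
  have μB1_0 : μB1 0 = 0 := if_pos rfl
  have μB1_ne : ∀ k, k ≠ 0 → μB1 k = 4 * β₁ * β₂ / K := fun k hk => if_neg hk
  have h𝒞def : ∀ k, 𝒞 k = (κ₁ (k + 1) - κ₁ k) - μB1 k * a1hi k := fun k => rfl
  have μA2_0 : μA2 0 = 0 := if_pos rfl
  have μA2_ne : ∀ k, k ≠ 0 → μA2 k = a1lo k / 𝒞 (k - 1) := fun k hk => if_neg hk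
  have hŵdef : ∀ k, ŵ k = a1hi k - μA2 k * D0 (k - 1) := fun k => rfl
  -- positivity of the pivots
  have ha1lo : ∀ k, 0 ≤ a1lo k := fun k => by rw [ha1lo_def]; positivity
  have hμB1nn : ∀ k, 0 ≤ μB1 k := by
    intro k
    by_cases h0 : k = 0
    · rw [h0, μB1_0]
    · rw [μB1_ne k h0]; positivity
  -- 𝒞 in closed form
  have h𝒞0 : 𝒞 0 = K := by
    rw [h𝒞def, μB1_0, zero_mul, sub_zero, hΔ1, hKdef]; push_cast; ring
  have h𝒞ge1 : ∀ k : ℕ, 1 ≤ k → 𝒞 k = (2 * k * (β₁ ^ 2 * r₂ + β₂ ^ 2 * (r₁ + 1))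
      + (β₁ * r₂ - β₂ * (r₁ + 1)) ^ 2 + 4 * β₁ * β₂ * r₂) / K := by
    intro k hk
    rw [h𝒞def, μB1_ne k (by omega), ha1hi_def, hΔ1, hKdef]
    field_simp
    ring
  have hN𝒞pos : ∀ k : ℕ, 0 < 2 * (k : ℝ) * (β₁ ^ 2 * r₂ + β₂ ^ 2 * (r₁ + 1))
      + (β₁ * r₂ - β₂ * (r₁ + 1)) ^ 2 + 4 * β₁ * β₂ * r₂ := fun k => by positivity
  have h𝒞pos : ∀ k, 0 < 𝒞 k := by
    intro k
    rcases Nat.eq_zero_or_pos k with rfl | hk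
    · rw [h𝒞0]; exact hK
    · rw [h𝒞ge1 k hk]; exact div_pos (hN𝒞pos k) hK
  have hμA2nn : ∀ k, 0 ≤ μA2 k := by
    intro k
    by_cases h0 : k = 0
    · rw [h0, μA2_0]
    · rw [μA2_ne k h0]; exact div_nonneg (ha1lo k) (h𝒞pos _).le
  -- ŵ: small values and the closed form ŵ(k+1)·K𝒞(k) = r₂·𝒫₂(k)
  have hŵ0 : ŵ 0 = r₁ * r₂ := by
    rw [hŵdef, μA2_0, zero_mul, sub_zero, ha1hi_def]; push_cast; ring
  have hŵ1 : ŵ 1 = r₁ * r₂ := by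
    rw [hŵdef, μA2_ne 1 one_ne_zero, ha1lo_def, ha1hi_def, Nat.sub_self, h𝒞0, hD0, hΔ0]
    push_cast
    field_simp
    ring
  have hŵge2 : ∀ k : ℕ, 1 ≤ k → ŵ (k + 1) * (2 * (k : ℝ) * (β₁ ^ 2 * r₂ + β₂ ^ 2 * (r₁ + 1))
      + (β₁ * r₂ - β₂ * (r₁ + 1)) ^ 2 + 4 * β₁ * β₂ * r₂)
      = r₂ * (r₁ * (β₁ * (k + r₂) - β₂ * (k + r₁ + 1)) ^ 2 + 2 * β₁ * β₂ * r₁ * (r₂ - r₁ - 1)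
        + (β₁ - β₂) ^ 2 * ((k : ℝ) * (k + r₁ + 1))) := by
    intro k hk
    rw [hŵdef, μA2_ne (k + 1) (by omega), ha1lo_def, ha1hi_def, Nat.add_sub_cancel, h𝒞ge1 k hk,
      hD0, hΔ0, hKdef]
    push_cast
    have hden : 2 * (k : ℝ) * (β₁ ^ 2 * r₂ + β₂ ^ 2 * (r₁ + 1))
      + (β₁ * r₂ - β₂ * (r₁ + 1)) ^ 2 + 4 * β₁ * β₂ * r₂ ≠ 0 := (hN𝒞pos k).ne'
    have hKne' : β₁ * r₂ + β₂ * (1 + r₁) ≠ 0 := by rw [← hKdef]; exact hKne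
    field_simp
    ring
  have hŵpos : ∀ k, 0 < ŵ k := by
    intro k
    rcases Nat.lt_or_ge k 2 with hk | hk
    · interval_cases k
      · rw [hŵ0]; positivity
      · rw [hŵ1]; positivity
    · obtain ⟨j, rfl⟩ : ∃ j, k = j + 2 := ⟨k - 2, by omega⟩
      have hj1 : 1 ≤ j + 1 := by omega
      have hpos := keyPivot_pos β₁ β₂ r₁ r₂ ((j + 1 : ℕ) : ℝ) hb₁ hb₂ hr₁ hr₂ hne (by positivity)
      have hid := hŵge2 (j + 1) hj1
      have hprod : 0 < ŵ (j + 1 + 1) * (2 * ((j + 1 : ℕ) : ℝ) * (β₁ ^ 2 * r₂ + β₂ ^ 2 * (r₁ + 1))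
          + (β₁ * r₂ - β₂ * (r₁ + 1)) ^ 2 + 4 * β₁ * β₂ * r₂) := by
        rw [hid]; exact mul_pos hr₂pos hpos
      exact pos_of_mul_pos_left hprod (hN𝒞pos (j + 1)).le
  -- the row kernels of the five stages
  let rowW : ℕ → ℕ → ℝ := fun k l =>
    if l = k then κ₀ k else if l + 1 = k then κ₁ k else if l + 2 = k then κ₂ k else 0
  let rowC : ℕ → ℕ → ℝ := fun k l =>
    if l = k + 1 then κ₀ (k + 1) - κ₀ k else if l = k then κ₁ (k + 1) - κ₁ k
      else if l + 1 = k then κ₂ (k + 1) - κ₂ k else 0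
  let A1 : ℕ → ℕ → ℝ := fun k l => if l = k then a1hi k else if l + 1 = k then a1lo k else 0
  let B1 : ℕ → ℕ → ℝ := fun k l => if l = k then 𝒞 k else if l = k + 1 then D0 k else 0
  let A2 : ℕ → ℕ → ℝ := fun k l => if l = k then ŵ k else 0
  let B2 : ℕ → ℕ → ℝ := fun k l => if l = k + 1 then D0 k else 0
  let A3 : ℕ → ℕ → ℝ := fun k l => if k = 0 ∧ l = 0 then r₁ * r₂ else 0
  -- stage identities, row by row
  have I1zero : ∀ l, rowW 0 l = A1 0 l := by
    intro l; simp only [rowW, A1, ha1hi_def, hκ₀0]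
    split_ifs <;> first | (exfalso; omega) | (push_cast; ring)
  have I1E : ∀ k l, rowW (k + 1) l = A1 (k + 1) l + (((k + 1 : ℕ) : ℝ) / 2) * rowC k l := by
    intro k l
    simp only [rowW, rowC, A1, ha1hi_def, ha1lo_def]
    split_ifs <;> first | (exfalso; omega) | skip
    · rw [hΔ0, hκ₀]; push_cast; ring
    · rw [hΔ1, hκ₁, hKdef]; push_cast; ring
    · rw [hΔ2, hκ₂]; push_cast; ring
    · ring
  have I2 : ∀ k l, rowC k l = B1 k l + μB1 k * A1 k l := by
    intro k l
    simp only [rowC, B1, A1]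
    split_ifs <;> first | (exfalso; omega) | skip
    · ring
    · simp only [𝒞]; ring
    · have hk : k ≠ 0 := by omega
      simp only [μB1, if_neg hk]
      rw [zero_add, hΔ2, ha1lo_def, hKdef]
      field_simp
      ring
    · ring
  have I3zero : ∀ l, A1 0 l = A2 0 l := by
    intro l; simp only [A1, A2, ha1hi_def, hŵ0]
    split_ifs <;> first | (exfalso; omega) | (push_cast; ring)
  have I3E : ∀ k l, A1 (k + 1) l = A2 (k + 1) l + μA2 (k + 1) * B1 k l := by
    intro k l
    simp only [A1, A2, B1]
    split_ifs <;> first | (exfalso; omega) | skip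
    · simp only [ŵ, Nat.add_sub_cancel]; ring
    · simp only [μA2, if_neg (show k + 1 ≠ 0 by omega), Nat.add_sub_cancel]
      rw [zero_add, div_mul_cancel₀ _ (h𝒞pos k).ne']
    · ring
  have I4 : ∀ k l, B1 k l = B2 k l + (𝒞 k / ŵ k) * A2 k l := by
    intro k l
    simp only [B1, B2, A2]
    split_ifs <;> first | (exfalso; omega) | skip
    · rw [zero_add, div_mul_cancel₀ _ (hŵpos k).ne']
    · ring
    · ring
  have I5zero : ∀ l, A2 0 l = A3 0 l := by
    intro l; simp only [A2, A3, hŵ0, true_and]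
  have I5E : ∀ k l, A2 (k + 1) l = A3 (k + 1) l + (ŵ (k + 1) / D0 k) * B2 k l := by
    intro k l
    simp only [A2, A3, B2, if_neg (show ¬ (k + 1 = 0 ∧ l = 0) by omega), zero_add]
    split_ifs
    · rw [div_mul_cancel₀ _ (hΔ0pos k).ne']
    · rw [mul_zero]
  -- total nonnegativity, stage by stage (from U = (A3 | B2) back to (rowW | rowC))
  let R5 : ℕ → ℕ → ℝ := fun t l => if t % 2 = 0 then A3 (t / 2) l else B2 (t / 2) l
  let R4 : ℕ → ℕ → ℝ := fun t l => if t % 2 = 0 then A2 (t / 2) l else B2 (t / 2) l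
  let R3 : ℕ → ℕ → ℝ := fun t l => if t % 2 = 0 then A2 (t / 2) l else B1 (t / 2) l
  let R2 : ℕ → ℕ → ℝ := fun t l => if t % 2 = 0 then A1 (t / 2) l else B1 (t / 2) l
  let R1 : ℕ → ℕ → ℝ := fun t l => if t % 2 = 0 then A1 (t / 2) l else rowC (t / 2) l
  let e5 : ℕ → ℝ := fun t => if t % 2 = 0 then (if t / 2 = 0 then 0 else ŵ (t / 2) / D0 (t / 2 - 1)) else 0
  let e4 : ℕ → ℝ := fun t => if t % 2 = 0 then 0 else 𝒞 (t / 2) / ŵ (t / 2)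
  let e3 : ℕ → ℝ := fun t => if t % 2 = 0 then μA2 (t / 2) else 0
  let e2 : ℕ → ℝ := fun t => if t % 2 = 0 then 0 else μB1 (t / 2)
  let e1 : ℕ → ℝ := fun t => if t % 2 = 0 then ((t / 2 : ℕ) : ℝ) / 2 else 0
  have T5 : ∀ (k' : ℕ) (r' c' : Fin k' → ℕ), StrictMono r' → StrictMono c' →
      0 ≤ (Matrix.of fun i j => R5 (r' i) (c' j)).det := by
    intro k' r' c' hr' hc'
    refine StairTN.stairs_minor_nonneg R5 (fun t => (t + 1) / 2) (fun t => (t + 1) / 2)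
      (fun _ => le_rfl) (fun t => by omega) ?_ ?_ ?_ r' c' hr' hc'
    · intro t l
      show 0 ≤ (if t % 2 = 0 then A3 (t / 2) l else B2 (t / 2) l)
      by_cases h : t % 2 = 0
      · rw [if_pos h]; show 0 ≤ (if t / 2 = 0 ∧ l = 0 then r₁ * r₂ else 0); split_ifs
        · positivity
        · exact le_rfl
      · rw [if_neg h]; show 0 ≤ (if l = t / 2 + 1 then D0 (t / 2) else 0); split_ifs
        · exact (hΔ0pos _).le
        · exact le_rfl
    · intro t l hl
      show (if t % 2 = 0 then A3 (t / 2) l else B2 (t / 2) l) = 0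
      by_cases h : t % 2 = 0
      · rw [if_pos h]; exact if_neg (by omega)
      · rw [if_neg h]; exact if_neg (by omega)
    · intro t l hl
      show (if t % 2 = 0 then A3 (t / 2) l else B2 (t / 2) l) = 0
      by_cases h : t % 2 = 0
      · rw [if_pos h]; exact if_neg (by omega)
      · rw [if_neg h]; exact if_neg (by omega)
  have T4 : ∀ (k' : ℕ) (r' c' : Fin k' → ℕ), StrictMono r' → StrictMono c' →
      0 ≤ (Matrix.of fun i j => R4 (r' i) (c' j)).det := by
    intro k' r' c' hr' hc'
    have heq : (Matrix.of fun i j => R4 (r' i) (c' j)) =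
        Matrix.of fun i j => R5 (r' i) (c' j) + e5 (r' i) * R5 (r' i - 1) (c' j) := by
      ext i j
      exact interleave_step A2 B2 A3 B2 (fun k => if k = 0 then 0 else ŵ k / D0 (k - 1)) (fun _ => 0)
        I5zero (fun k l => by rw [if_neg (by omega), Nat.add_sub_cancel]; exact I5E k l)
        (fun k l => by ring) (if_pos rfl) (r' i) (c' j)
    rw [heq]
    refine HurwitzPair.step_tn R5 e5 (fun t => ?_) ?_ T5 r' c' hr' hc'
    · show 0 ≤ (if t % 2 = 0 then (if t / 2 = 0 then 0 else ŵ (t / 2) / D0 (t / 2 - 1)) else 0)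
      split_ifs
      · exact le_rfl
      · exact div_nonneg (hŵpos _).le (hΔ0pos _).le
      · exact le_rfl
    · show (if 0 % 2 = 0 then (if 0 / 2 = 0 then (0:ℝ) else ŵ (0 / 2) / D0 (0 / 2 - 1)) else 0) = 0
      rw [if_pos rfl, if_pos rfl]
  have T3 : ∀ (k' : ℕ) (r' c' : Fin k' → ℕ), StrictMono r' → StrictMono c' →
      0 ≤ (Matrix.of fun i j => R3 (r' i) (c' j)).det := by
    intro k' r' c' hr' hc'
    have heq : (Matrix.of fun i j => R3 (r' i) (c' j)) =
        Matrix.of fun i j => R4 (r' i) (c' j) + e4 (r' i) * R4 (r' i - 1) (c' j) := by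
      ext i j
      exact interleave_step A2 B1 A2 B2 (fun _ => 0) (fun k => 𝒞 k / ŵ k)
        (fun l => rfl) (fun k l => by ring) I4 rfl (r' i) (c' j)
    rw [heq]
    refine HurwitzPair.step_tn R4 e4 (fun t => ?_) ?_ T4 r' c' hr' hc'
    · show 0 ≤ (if t % 2 = 0 then (0:ℝ) else 𝒞 (t / 2) / ŵ (t / 2))
      split_ifs
      · exact le_rfl
      · exact div_nonneg (h𝒞pos _).le (hŵpos _).le
    · exact if_pos rfl
  have T2 : ∀ (k' : ℕ) (r' c' : Fin k' → ℕ), StrictMono r' → StrictMono c' →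
      0 ≤ (Matrix.of fun i j => R2 (r' i) (c' j)).det := by
    intro k' r' c' hr' hc'
    have heq : (Matrix.of fun i j => R2 (r' i) (c' j)) =
        Matrix.of fun i j => R3 (r' i) (c' j) + e3 (r' i) * R3 (r' i - 1) (c' j) := by
      ext i j
      exact interleave_step A1 B1 A2 B1 μA2 (fun _ => 0) I3zero I3E (fun k l => by ring) μA2_0 (r' i) (c' j)
    rw [heq]
    refine HurwitzPair.step_tn R3 e3 (fun t => ?_) ?_ T3 r' c' hr' hc'
    · show 0 ≤ (if t % 2 = 0 then μA2 (t / 2) else 0)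
      split_ifs
      · exact hμA2nn _
      · exact le_rfl
    · show (if 0 % 2 = 0 then μA2 (0 / 2) else 0) = 0
      rw [if_pos rfl]; exact μA2_0
  have T1 : ∀ (k' : ℕ) (r' c' : Fin k' → ℕ), StrictMono r' → StrictMono c' →
      0 ≤ (Matrix.of fun i j => R1 (r' i) (c' j)).det := by
    intro k' r' c' hr' hc'
    have heq : (Matrix.of fun i j => R1 (r' i) (c' j)) =
        Matrix.of fun i j => R2 (r' i) (c' j) + e2 (r' i) * R2 (r' i - 1) (c' j) := by
      ext i j
      exact interleave_step A1 rowC A1 B1 (fun _ => 0) μB1 (fun l => rfl) (fun k l => by ring) I2 rfl (r' i) (c' j)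
    rw [heq]
    refine HurwitzPair.step_tn R2 e2 (fun t => ?_) ?_ T2 r' c' hr' hc'
    · show 0 ≤ (if t % 2 = 0 then (0:ℝ) else μB1 (t / 2))
      split_ifs
      · exact le_rfl
      · exact hμB1nn _
    · exact if_pos rfl
  -- the last stage: (rowW | rowC) = E₁ · (A1 | rowC)
  have heq : (Matrix.of fun i j =>
      if r i % 2 = 0 then
        (if c j = r i / 2 then κ₀ (r i / 2) else if c j + 1 = r i / 2 then κ₁ (r i / 2)
          else if c j + 2 = r i / 2 then κ₂ (r i / 2) else 0)
      else
        (if c j = r i / 2 + 1 then κ₀ (r i / 2 + 1) - κ₀ (r i / 2)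
          else if c j = r i / 2 then κ₁ (r i / 2 + 1) - κ₁ (r i / 2)
          else if c j + 1 = r i / 2 then κ₂ (r i / 2 + 1) - κ₂ (r i / 2) else 0)) =
      Matrix.of fun i j => R1 (r i) (c j) + e1 (r i) * R1 (r i - 1) (c j) := by
    ext i j
    exact interleave_step rowW rowC A1 rowC (fun k => ((k : ℕ) : ℝ) / 2) (fun _ => 0)
      I1zero I1E (fun k l => by ring) (by simp) (r i) (c j)
  rw [heq]
  refine HurwitzPair.step_tn R1 e1 (fun t => ?_) ?_ T1 r c hr hc
  · show 0 ≤ (if t % 2 = 0 then ((t / 2 : ℕ) : ℝ) / 2 else 0)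
    split_ifs
    · positivity
    · exact le_rfl
  · show (if 0 % 2 = 0 then ((0 / 2 : ℕ) : ℝ) / 2 else 0) = 0
    rw [if_pos rfl]; simp

end TwoFactorHurwitz

end Summit.CriticalPhenomena.PercolationContinuityZ3.Theorems
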